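import Summits.QuantumFields.BalabanUV.Beta.GAN24.MonotoneCoarsenReadOut
import Literature.MathematicalPhysics.QuantumFieldTheory.Balaban1983to89.B5AverageCurlStokes
import Literature.MathematicalPhysics.QuantumFieldTheory.Balaban1983to89.B5Composition116

/-!
# Beta / GAN24 / MonotoneTorusTower — THE READ-OUT CHAIN INSTANTIATED ON BAŁABAN'S TYPED TORUS AVERAGES: under lattice refinement by
# one averaging step `Q_{Lc}` (B5 (1.18)), the sub-block read-outs of the block-constrained covariance of the (degenerate, un-gauge-fixed)
# curl energy form form a LOEWNER-ANTITONE chain — (STAB_j) = Federbush's stability of the averaging map, (1.17) = the composition of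
# averages, both IN THE TREE BY NAME; no rate, no constant, no gauge fixing
# (gan24-p4 gen 3; SKELETON-P4 nodes N2 + N3 + N5 (N4 as the criticality hypothesis ∕ `GAN24/MonotoneCritical`), torus avatar;
# BINDER-OWNERS row G-an2-4 ∕ (CONV-C), ALTERNATIVE DISCHARGE «rate OR monotonicity»; NOT IN PRINT — our proof attempt)

HONEST FRAMING (page 1 of everything the β sub-cell writes): discharging `BetaPertH` makes Bałaban's UV stability UNCONDITIONAL — a
real constructive-QFT result; it is NOT the continuum limit and NOT the Clay problem.  HONEST DEPENDENCY (cell reorg 2026-08-19, verbatim):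
«continuum YM on T⁴ ⇐ BetaPertH ∧ nine spine estimates (0/9 proved); BetaPertH ⇐ (D1) ∧ (D4) ∧ CAP+tail; G-an2-4 gates asym, D1 and NE2/3/4.»
HONEST LABEL: «not in print; our proof attempt; alternative discharge of the G-an2-4 row (rate OR monotonicity)»; 0 wall binders instantiated.
ABSOLUTE RULE honoured: NOTHING is cited here as a fact.  The two analytic∕combinatorial inputs are TREE THEOREMS consumed BY NAME:
`B5AverageCurlStokes.sum_normSq_plaq_QvOp_le` (Federbush's Abelian Stability Theorem for the typed average `QvOp`, constant exactly `1`,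
kernel-proved there for every `d`, block side and torus) and `B5Composition116.QvOp_comp` (`Q_m ∘ Q_n = Q_{mn}`, kernel-proved there);
everything else is [folklore] finite-dimensional linear algebra over gen 2's `MonotoneCoarsenReadOut.readOut_chain_step`.

## THE OBJECTS (B5 typing of `B5Prop11Plancherel` ∕ `B5Block118`: `Tor N = Π_μ ℤ/N_μ`, `fine n M = (n·M_μ)_μ`, `QvOp n M` = (1.18))
Fix the READ-OUT torus `Tor M` (`M_μ ≥ 1`; in the wall's geometry `M = fine Lc M₀`: the `Lc⁻¹`-sub-blocks of the unit lattice `Tor M₀`) and the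
averaging factor `Lc ≥ 1`.  Level `j` carries the fine 1-forms `Lev j := Tor (fine (Lc^j) M) × Fin d` (block side `Lc^j` over the read-out
lattice), and
* `sread j := QvOp (Lc^j) M` — the level-`j` field READ through the sub-block contour means (1.18) (a true average);
* `cstep j := QvOp Lc (fine (Lc^j) M)` (re-indexed along `B5Composition116.sitesV`) — ONE Bałaban averaging from level `j+1` to level `j`;
* `rows R j := R * sread j` — hard constraint rows factoring through the read-out lattice (`R = QvOp Lc M₀`: the UNIT-block averages,
  `unitBlock_rows`; `R = 1`: all sub-block averages);
* `hform j := (Lc²/Lc^d)^j • (curlMat)ᴴ curlMat` — the curl energy `Σ_{x,μ,ν} |plaq A μ ν x|²` in the units in which one averaging step does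
  not increase it (the continuum normalisation `a^{d−2}·Σ|plaq|²` up to a `j`-independent factor); DEGENERATE (pure gauges), no gauge fixing.

## WHAT IS PROVED
* §1 `curlMat`, `curlMat_mulVec` (`= plaq`), `quad_conjTranspose_mul_self`, `hform_quad`, `hform_posSemidef`.
* §2 `sread_comp : sread j * cstep j = sread (j+1)` and `rows_comp` — (1.17) BY NAME (`QvOp_comp`); `unitBlock_rows`.
* §3 **`stab_step`**: `(hform (j+1) − (cstep j)ᴴ * hform j * cstep j).PosSemidef` for EVERY `j` — Federbush BY NAME, summed over planes,
  transported along `sitesV` (`plaq_sitesV`, `curlEnergy_reindex`).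
* §4 **`readOut_chain_torus`**: for every test-form matrix `T` on the read-out lattice, every constraint matrix `R` there, and every family of
  Hermitian matrices `Γ j` on `Lev j` whose columns at the read sources `(T * sread j)ᴴ u` are CRITICAL (`MonotoneCoarsen.IsCrit`) for `hform j` on
  `ker (rows R j)` — e.g. the KKT covariance of ANY legitimate gauge slice, or `MonotoneCritical.critCov` — the read-out matrices
  `P j := (T * sread j) * Γ j * (T * sread j)ᴴ` satisfy `(P j − P (j+1)).PosSemidef` for all `j ≥ 0`.  **`readOut_entry_dev_le_torus`** (+ ONE trace
  datum from a level `k₀`): every entry of `P j − P j'`, `j, j' ≥ k₀`, is bounded by `η₀`, and `re tr P j` is `MonotoneTailDown` — (MONO-K)₂, NO rate.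
WHAT IS NOT CLAIMED: no decay, no rate, no identification with an2's `ℤ^{d+1}` wall system `KInvStep` (the torus avatar only), no discharge of the
criticality hypothesis for a specific `T` (legitimacy of transverse ∕ block-constant-divergence test forms needs the discrete Poincaré lemma on
the torus — not in this file), nothing about the pure-gauge section of the wall's slot.  NOT BetaPertH, NOT continuum, NOT Clay.
-/

noncomputable section

namespace Summit.QuantumFields.BalabanUV.Beta.GAN24.MonotoneTorusTower

open Matrix Finset
open scoped BigOperators ComplexOrder ComplexConjugate
open Literature.MathematicalPhysics.QuantumFieldTheory.Balaban1983to89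
open Literature.MathematicalPhysics.QuantumFieldTheory.Balaban1983to89.B5Prop11Plancherel (Tor fine unitVec)
open Literature.MathematicalPhysics.QuantumFieldTheory.Balaban1983to89.B5Block118 (QvOp tstep tstep_succ tstep_zero)
open Literature.MathematicalPhysics.QuantumFieldTheory.Balaban1983to89.B5AverageCurlStokes (plaq plaq_apply sum_normSq_plaq_QvOp_le)
open Literature.MathematicalPhysics.QuantumFieldTheory.Balaban1983to89.B5Composition116 (recast recast_add recast_tstep sites sitesV
  sitesV_symm_apply fine_fine QvOp_comp)
open Summit.QuantumFields.BalabanUV.Beta.GAN24.MonotoneCoarsen (IsCrit conj_pairing)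
open Summit.QuantumFields.BalabanUV.Beta.GAN24.MonotoneCoarsenReadOut (readOut_chain_step readOut_entry_dev_le_of_stab)
open Summit.QuantumFields.BalabanUV.Beta.CapRowsTail (MonotoneTailDown)

variable {d : ℕ}

/-! ## §1 The curl matrix and the curl energy form -/

section Curl

variable (N : Fin d → ℕ) [hN : ∀ μ, NeZero (N μ)]

/-- THE CURL MATRIX: row `(μ, ν, x)` of `curlMat N *ᵥ A` is the plaquette sum `plaq N A μ ν x = A(x,μ) + A(x+e_μ,ν) − A(x+e_ν,μ) − A(x,ν)`
(`curlMat_mulVec`). [folklore] -/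
def curlMat : Matrix (Fin d × Fin d × Tor N) (Tor N × Fin d) ℂ := fun r b =>
  (if b = (r.2.2, r.1) then 1 else 0) + (if b = (r.2.2 + unitVec N r.1, r.2.1) then 1 else 0)
    - (if b = (r.2.2 + unitVec N r.2.1, r.1) then 1 else 0) - (if b = (r.2.2, r.2.1) then 1 else 0)

/-- `curlMat N *ᵥ A` at `(μ, ν, x)` is `plaq N A μ ν x`. [folklore] -/
theorem curlMat_mulVec (A : Tor N × Fin d → ℂ) (μ ν : Fin d) (x : Tor N) :
    (curlMat N *ᵥ A) (μ, ν, x) = plaq N A μ ν x := by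
  simp only [mulVec, dotProduct, curlMat, add_mul, sub_mul, ite_mul, one_mul, zero_mul, Finset.sum_add_distrib,
    Finset.sum_sub_distrib, Finset.sum_ite_eq', Finset.mem_univ, if_true, plaq_apply]

/-- The curl energy `Σ_μ Σ_ν Σ_x |plaq A μ ν x|²` (every ordered pair of directions; the `μ = ν` terms vanish and `(ν,μ)` repeats `(μ,ν)` —
an overall factor, immaterial for the Loewner statements). [folklore] -/
def curlEnergy (A : Tor N × Fin d → ℂ) : ℝ := ∑ μ : Fin d, ∑ ν : Fin d, ∑ x : Tor N, ‖plaq N A μ ν x‖ ^ 2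

/-- `curlEnergy ≥ 0`. [folklore] -/
theorem curlEnergy_nonneg (A : Tor N × Fin d → ℂ) : 0 ≤ curlEnergy N A := by
  unfold curlEnergy; positivity

omit hN in
/-- `⟨v, (Cᴴ C) v⟩ = Σ_i |(C v)_i|²` (as a complex number). [folklore] -/
theorem quad_conjTranspose_mul_self {r n : Type*} [Fintype r] [Fintype n] (C : Matrix r n ℂ) (v : n → ℂ) :
    star v ⬝ᵥ ((Cᴴ * C) *ᵥ v) = ((∑ i, ‖(C *ᵥ v) i‖ ^ 2 : ℝ) : ℂ) := by
  rw [← mulVec_mulVec, ← conj_pairing]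
  simp only [dotProduct, Pi.star_apply, Complex.star_def, Complex.conj_mul', Complex.ofReal_sum, Complex.ofReal_pow]

/-- `⟨A, (curlMatᴴ curlMat) A⟩ = curlEnergy A`. [folklore] -/
theorem quad_curlMat (A : Tor N × Fin d → ℂ) :
    star A ⬝ᵥ (((curlMat N)ᴴ * curlMat N) *ᵥ A) = ((curlEnergy N A : ℝ) : ℂ) := by
  rw [quad_conjTranspose_mul_self, curlEnergy]
  congr 1
  rw [Fintype.sum_prod_type]
  refine Finset.sum_congr rfl fun μ _ => ?_
  rw [Fintype.sum_prod_type]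
  refine Finset.sum_congr rfl fun ν _ => Finset.sum_congr rfl fun x _ => ?_
  rw [curlMat_mulVec]

end Curl

/-! ## §2 The tower over a read-out torus: readings, one-step averagings, constraint rows; the composition law (1.17) -/

section Tower

variable (Lc : ℕ) [NeZero Lc] (M : Fin d → ℕ) [hM : ∀ μ, NeZero (M μ)]

/-- Level-`j` index of fine 1-forms: sites of the torus of block side `Lc^j` over the read-out torus, times directions. [folklore] -/
abbrev Lev (j : ℕ) : Type := Tor (fine (Lc ^ j) M) × Fin d

/-- THE READING at level `j`: the sub-block contour means (1.18) `QvOp (Lc^j) M` onto the read-out lattice. [folklore] -/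
def sread (j : ℕ) : Matrix (Tor M × Fin d) (Lev Lc M j) ℂ := QvOp (Lc ^ j) M

/-- ONE BAŁABAN AVERAGING STEP from level `j+1` to level `j`: `QvOp Lc (fine (Lc^j) M)`, the fine sites re-indexed along
`B5Composition116.sitesV` (`(Lc^j·Lc)·M_μ = Lc·(Lc^j·M_μ)`). [folklore] -/
def cstep (j : ℕ) : Matrix (Lev Lc M j) (Lev Lc M (j + 1)) ℂ :=
  (QvOp Lc (fine (Lc ^ j) M)).submatrix id (sitesV (Lc ^ j) Lc M)

/-- CONSTRAINT ROWS factoring through the read-out lattice: `rows R j := R * sread j`. [folklore] -/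
def rows {c : Type*} (R : Matrix c (Tor M × Fin d) ℂ) (j : ℕ) : Matrix c (Lev Lc M j) ℂ := R * sread Lc M j

/-- **(1.17) FOR THE READINGS**: `sread j * cstep j = sread (j+1)` — `Q_{Lc^j} ∘ Q_{Lc} = Q_{Lc^{j+1}}`, the tree's `B5Composition116.QvOp_comp`
BY NAME. [folklore] -/
theorem sread_comp (j : ℕ) : sread Lc M j * cstep Lc M j = sread Lc M (j + 1) := by
  unfold sread cstep
  exact QvOp_comp (Lc ^ j) Lc M

/-- (1.17) for the constraint rows: `rows R j * cstep j = rows R (j+1)`. [folklore] -/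
theorem rows_comp {c : Type*} (R : Matrix c (Tor M × Fin d) ℂ) (j : ℕ) :
    rows Lc M R j * cstep Lc M j = rows Lc M R (j + 1) := by
  unfold rows
  rw [Matrix.mul_assoc, sread_comp]

/-- `cstep j` maps `ker (rows R (j+1))` into `ker (rows R j)`. [folklore] -/
theorem cstep_mulVec_mem_ker {c : Type*} [Fintype c] (R : Matrix c (Tor M × Fin d) ℂ) (j : ℕ) (v : Lev Lc M (j + 1) → ℂ)
    (hv : v ∈ LinearMap.ker (rows Lc M R (j + 1)).mulVecLin) :
    cstep Lc M j *ᵥ v ∈ LinearMap.ker (rows Lc M R j).mulVecLin := by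
  simp only [LinearMap.mem_ker, Matrix.mulVecLin_apply] at hv ⊢
  rw [mulVec_mulVec, rows_comp, hv]

/-- DICTIONARY: over a unit torus `Tor M₀` with read-out lattice `M = fine Lc M₀` and `R = QvOp Lc M₀` (unit-block averages), the constraint
rows ARE the unit-block averages (1.18) of the level-`j` field, `QvOp (Lc·Lc^j) M₀`, re-indexed (`QvOp_comp` again). [folklore] -/
theorem unitBlock_rows (M₀ : Fin d → ℕ) [∀ μ, NeZero (M₀ μ)] (j : ℕ) :
    rows Lc (fine Lc M₀) (QvOp Lc M₀) j = (QvOp (Lc * Lc ^ j) M₀).submatrix id (sitesV Lc (Lc ^ j) M₀).symm := by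
  unfold rows sread
  rw [← QvOp_comp Lc (Lc ^ j) M₀, Matrix.submatrix_mul _ _ id id _ Function.bijective_id, Matrix.submatrix_id_id,
    Matrix.submatrix_submatrix, Function.comp_id, Equiv.self_comp_symm, Matrix.submatrix_id_id]

end Tower

/-! ## §3 The curl energy per level and (STAB_j): one averaging step does not increase it (Federbush, BY NAME) -/

section Stab

variable (Lc : ℕ) [NeZero Lc] (M : Fin d → ℕ) [hM : ∀ μ, NeZero (M μ)]

/-- The unit factor `(Lc²/Lc^d)^j` of the level-`j` curl energy. [folklore] -/
def scal (j : ℕ) : ℝ := ((Lc : ℝ) ^ 2 / (Lc : ℝ) ^ d) ^ j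

omit [NeZero Lc] in
/-- `scal j ≥ 0`. [folklore] -/
theorem scal_nonneg (j : ℕ) : 0 ≤ scal (d := d) Lc j := by unfold scal; positivity

omit [NeZero Lc] in
/-- `scal (j+1) = scal j · Lc²/Lc^d`. [folklore] -/
theorem scal_succ (j : ℕ) : scal (d := d) Lc (j + 1) = scal (d := d) Lc j * ((Lc : ℝ) ^ 2 / (Lc : ℝ) ^ d) := by
  unfold scal; rw [pow_succ]

/-- THE LEVEL-`j` CURL ENERGY FORM `(Lc²/Lc^d)^j • curlMatᴴ curlMat` on `Lev j` (degenerate: pure gauges are null). [folklore] -/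
def hform (j : ℕ) : Matrix (Lev Lc M j) (Lev Lc M j) ℂ :=
  ((scal (d := d) Lc j : ℝ) : ℂ) • ((curlMat (fine (Lc ^ j) M))ᴴ * curlMat (fine (Lc ^ j) M))

/-- `⟨v, hform j v⟩ = scal j · curlEnergy v`. [folklore] -/
theorem hform_quad (j : ℕ) (v : Lev Lc M j → ℂ) :
    star v ⬝ᵥ (hform Lc M j *ᵥ v) = ((scal (d := d) Lc j * curlEnergy (fine (Lc ^ j) M) v : ℝ) : ℂ) := by
  rw [hform, smul_mulVec, dotProduct_smul, quad_curlMat, smul_eq_mul, Complex.ofReal_mul]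

/-- `hform j` is Hermitian. [folklore] -/
theorem hform_isHermitian (j : ℕ) : (hform Lc M j).IsHermitian := by
  unfold hform
  exact (Matrix.isHermitian_conjTranspose_mul_self _).smul (by
    rw [IsSelfAdjoint, Complex.star_def, Complex.conj_ofReal])

/-- `hform j` is positive semidefinite. [folklore] -/
theorem hform_posSemidef (j : ℕ) : (hform Lc M j).PosSemidef := by
  refine PosSemidef.of_dotProduct_mulVec_nonneg (hform_isHermitian Lc M j) fun v => ?_
  rw [hform_quad]
  exact Complex.zero_le_real.mpr (mul_nonneg (scal_nonneg Lc j) (curlEnergy_nonneg _ v))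

omit [NeZero Lc] hM in
/-- `e_μ = 1·e_μ` in the `tstep` notation of `B5Block118`. [folklore] -/
theorem unitVec_eq_tstep (N : Fin d → ℕ) (μ : Fin d) : unitVec N μ = tstep N μ 1 := by
  rw [← zero_add (1 : ℕ), tstep_succ, tstep_zero, zero_add]

omit [NeZero Lc] hM in
/-- The site identification `sites` commutes with the unit steps: `sites (x + e_μ) = sites x + e_μ`. [folklore] -/
theorem sites_add_unitVec (j : ℕ) (x : Tor (fine (Lc ^ j * Lc) M)) (μ : Fin d) :
    sites (Lc ^ j) Lc M (x + unitVec _ μ) = sites (Lc ^ j) Lc M x + unitVec _ μ := by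
  unfold sites
  rw [recast_add, unitVec_eq_tstep, unitVec_eq_tstep, recast_tstep]

omit [NeZero Lc] hM in
/-- Plaquettes commute with the re-indexing `sitesV`: `plaq (v ∘ sitesV⁻¹) μ ν (sites x) = plaq v μ ν x`. [folklore] -/
theorem plaq_sitesV (j : ℕ) (v : Lev Lc M (j + 1) → ℂ) (μ ν : Fin d) (x : Tor (fine (Lc ^ j * Lc) M)) :
    plaq (fine Lc (fine (Lc ^ j) M)) (v ∘ (sitesV (Lc ^ j) Lc M).symm) μ ν (sites (Lc ^ j) Lc M x)
      = plaq (fine (Lc ^ j * Lc) M) v μ ν x := by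
  simp only [plaq_apply, Function.comp_apply, ← sites_add_unitVec, sitesV_symm_apply, Equiv.symm_apply_apply]

/-- The curl energy is invariant under the re-indexing `sitesV`. [folklore] -/
theorem curlEnergy_reindex (j : ℕ) (v : Lev Lc M (j + 1) → ℂ) :
    curlEnergy (fine Lc (fine (Lc ^ j) M)) (v ∘ (sitesV (Lc ^ j) Lc M).symm) = curlEnergy (fine (Lc ^ j * Lc) M) v := by
  unfold curlEnergy
  refine Finset.sum_congr rfl fun μ _ => Finset.sum_congr rfl fun ν _ => ?_
  rw [← Equiv.sum_comp (sites (Lc ^ j) Lc M)]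
  exact Finset.sum_congr rfl fun x _ => by rw [plaq_sitesV]

/-- **FEDERBUSH, SUMMED OVER PLANES AND TRANSPORTED TO THE TOWER**: `Lc^d · curlEnergy (cstep j v) ≤ Lc² · curlEnergy v` — the tree theorem
`B5AverageCurlStokes.sum_normSq_plaq_QvOp_le` BY NAME at block side `Lc` over the torus `fine (Lc^j) M`. [folklore] -/
theorem curlEnergy_cstep_le (j : ℕ) (v : Lev Lc M (j + 1) → ℂ) :
    (Lc : ℝ) ^ d * curlEnergy (fine (Lc ^ j) M) (cstep Lc M j *ᵥ v) ≤ (Lc : ℝ) ^ 2 * curlEnergy (fine (Lc ^ j * Lc) M) v := by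
  have hc : cstep Lc M j *ᵥ v = QvOp Lc (fine (Lc ^ j) M) *ᵥ (v ∘ (sitesV (Lc ^ j) Lc M).symm) := by
    unfold cstep
    exact submatrix_mulVec_equiv _ v id _
  rw [hc, ← curlEnergy_reindex Lc M j v, curlEnergy, curlEnergy, Finset.mul_sum, Finset.mul_sum]
  refine Finset.sum_le_sum fun μ _ => ?_
  rw [Finset.mul_sum, Finset.mul_sum]
  refine Finset.sum_le_sum fun ν _ => ?_
  exact sum_normSq_plaq_QvOp_le Lc (fine (Lc ^ j) M) _ μ ν

/-- **(STAB_j) ON THE TORUS, EVERY `j`**: `(cstep j)ᴴ (hform j) (cstep j) ≤ hform (j+1)` — one Bałaban averaging step does not increase the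
(correctly scaled) curl energy.  Federbush's Abelian Stability Theorem, consumed by name; constant exactly `1`. [folklore] -/
theorem stab_step (j : ℕ) : (hform Lc M (j + 1) - (cstep Lc M j)ᴴ * hform Lc M j * cstep Lc M j).PosSemidef := by
  have hL : (0 : ℝ) < (Lc : ℝ) := by exact_mod_cast Nat.pos_of_ne_zero (NeZero.ne Lc)
  have h1 : ((cstep Lc M j)ᴴ * hform Lc M j * cstep Lc M j).IsHermitian :=
    Matrix.isHermitian_conjTranspose_mul_mul _ (hform_isHermitian Lc M j)
  refine PosSemidef.of_dotProduct_mulVec_nonneg ((hform_isHermitian Lc M (j + 1)).sub h1) fun v => ?_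
  have e : star v ⬝ᵥ (((cstep Lc M j)ᴴ * hform Lc M j * cstep Lc M j) *ᵥ v)
      = star (cstep Lc M j *ᵥ v) ⬝ᵥ (hform Lc M j *ᵥ (cstep Lc M j *ᵥ v)) := by
    rw [Matrix.mul_assoc, ← mulVec_mulVec, ← conj_pairing, mulVec_mulVec]
  rw [sub_mulVec, dotProduct_sub, e, hform_quad, hform_quad, ← Complex.ofReal_sub]
  refine Complex.zero_le_real.mpr (sub_nonneg.mpr ?_)
  rw [scal_succ, mul_assoc]
  refine mul_le_mul_of_nonneg_left ?_ (scal_nonneg Lc j)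
  -- `curlEnergy (cstep v) ≤ Lc²/Lc^d · curlEnergy v`
  rw [div_mul_eq_mul_div, le_div_iff₀ (by positivity), mul_comm]
  exact curlEnergy_cstep_le Lc M j v

end Stab

/-! ## §4 The read-out chain and (MONO-K)₂ on the torus -/

section Chain

variable (Lc : ℕ) [NeZero Lc] (M : Fin d → ℕ) [hM : ∀ μ, NeZero (M μ)]
variable {l c : Type*} [Fintype l] [Fintype c]

/-- **THE READ-OUT CHAIN ON BAŁABAN'S TORUS AVERAGES.**  For every test-form matrix `T` on the read-out lattice, every constraint matrix `R`
there, and every family of Hermitian covariance matrices `Γ j` whose columns at the read sources `(T * sread j)ᴴ u` are CRITICAL for the curl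
energy `hform j` on the gauge-FREE constraint space `ker (rows R j)` (the KKT covariance of any legitimate gauge slice; `MonotoneCritical.critCov`),
the read-out matrices `P j := (T * sread j) Γ j (T * sread j)ᴴ` DECREASE in the Loewner order at EVERY step:
`(P j − P (j+1)).PosSemidef`.  Inputs: `stab_step` (Federbush) and `sread_comp`∕`rows_comp` ((1.17)), into gen 2's
`MonotoneCoarsenReadOut.readOut_chain_step`. [folklore] -/
theorem readOut_chain_torus (T : Matrix l (Tor M × Fin d) ℂ) (R : Matrix c (Tor M × Fin d) ℂ)
    (Γ : ∀ j, Matrix (Lev Lc M j) (Lev Lc M j) ℂ) (hΓ : ∀ j, (Γ j)ᴴ = Γ j)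
    (hcrit : ∀ j (u : l → ℂ), IsCrit (hform Lc M j) ((T * sread Lc M j)ᴴ *ᵥ u) (LinearMap.ker (rows Lc M R j).mulVecLin)
      (Γ j *ᵥ ((T * sread Lc M j)ᴴ *ᵥ u))) (j : ℕ) :
    ((T * sread Lc M j) * Γ j * (T * sread Lc M j)ᴴ
      - (T * sread Lc M (j + 1)) * Γ (j + 1) * (T * sread Lc M (j + 1))ᴴ).PosSemidef :=
  readOut_chain_step (ι := Lev Lc M) (H := hform Lc M) (K := fun j => LinearMap.ker (rows Lc M R j).mulVecLin)
    (Cf := cstep Lc M) (S := fun j => T * sread Lc M j) (Γ := Γ) (k₀ := 0)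
    (fun j => hform_posSemidef Lc M j) (fun j v hv => cstep_mulVec_mem_ker Lc M R j v hv)
    (fun j => by rw [Matrix.mul_assoc, sread_comp]) hΓ hcrit (fun j _ => stab_step Lc M j) j (Nat.zero_le j)

/-- **(MONO-K)₂ ON THE TORUS FROM ONE TRACE DATUM — NO RATE.**  Under the hypotheses of `readOut_chain_torus` and ONE datum
`re tr (P k₀ − P j) ≤ η₀` for `j ≥ k₀`: every entry of `P j − P j'` (`j, j' ≥ k₀`) has norm `≤ η₀`, and `j ↦ re tr P j` is an5's
`MonotoneTailDown` from `k₀` (gen 2's `readOut_entry_dev_le_of_stab` ∘ gen 1's `MonotoneLoewner`). [folklore] -/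
theorem readOut_entry_dev_le_torus (T : Matrix l (Tor M × Fin d) ℂ) (R : Matrix c (Tor M × Fin d) ℂ)
    (Γ : ∀ j, Matrix (Lev Lc M j) (Lev Lc M j) ℂ) (hΓ : ∀ j, (Γ j)ᴴ = Γ j)
    (hcrit : ∀ j (u : l → ℂ), IsCrit (hform Lc M j) ((T * sread Lc M j)ᴴ *ᵥ u) (LinearMap.ker (rows Lc M R j).mulVecLin)
      (Γ j *ᵥ ((T * sread Lc M j)ᴴ *ᵥ u))) {k₀ : ℕ} {η₀ : ℝ}
    (hdat : ∀ j, k₀ ≤ j → ((T * sread Lc M k₀) * Γ k₀ * (T * sread Lc M k₀)ᴴ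
      - (T * sread Lc M j) * Γ j * (T * sread Lc M j)ᴴ).trace.re ≤ η₀) :
    (∀ j j', k₀ ≤ j → k₀ ≤ j' → ∀ a b,
        ‖((T * sread Lc M j) * Γ j * (T * sread Lc M j)ᴴ - (T * sread Lc M j') * Γ j' * (T * sread Lc M j')ᴴ) a b‖ ≤ η₀) ∧
      MonotoneTailDown (fun j => ((T * sread Lc M j) * Γ j * (T * sread Lc M j)ᴴ).trace.re) k₀ :=
  readOut_entry_dev_le_of_stab (ι := Lev Lc M) (H := hform Lc M) (K := fun j => LinearMap.ker (rows Lc M R j).mulVecLin)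
    (Cf := cstep Lc M) (S := fun j => T * sread Lc M j) (Γ := Γ) (k₀ := k₀)
    (fun j => hform_posSemidef Lc M j) (fun j v hv => cstep_mulVec_mem_ker Lc M R j v hv)
    (fun j => by rw [Matrix.mul_assoc, sread_comp]) hΓ hcrit (fun j _ => stab_step Lc M j) hdat

end Chain

end Summit.QuantumFields.BalabanUV.Beta.GAN24.MonotoneTorusTower

end
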